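import Summits.QuantumFields.BalabanUV.Beta.GAN24.FibreRateJM
import Summits.QuantumFields.BalabanUV.Beta.GAN24.PerfectResolventFibre
import Summits.QuantumFields.BalabanUV.Beta.FP.PerfectSymbolKBloch
import Summits.QuantumFields.BalabanUV.Beta.FP.KSlotHolds

/-!
# `BalabanUV.Beta.GAN24.RealRateKMHolds` — binder row G-an2-4 ∕ (CONV-C), lineage gan24-p3: **ROAD FP's X1m-K HOLDS — FOR EVERY `m ≥ 1`, EVERY `Lc ≥ 2`, IN
# DIMENSION FOUR, THE UNIT-RESCALED (j, m)-RESOLVENTS CONVERGE ENTRYWISE AS `j → ∞`**, with the explicit sup-norm rate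
# `(cFF + cMF + cMF + cmm)(Lc^m)·(Lc⁻²)^j∕(1 − Lc⁻²)` to the perfect `m`-fold resolvent `KPerf Lc (sfStep Lc) (smStep 3 Lc) m`; hence (unconditionally)
# `KPerf Lc … m = KPerf (Lc^m) … 1` (`PerfectRebase`), the perfect `m`-fold resolvent is the BLOCH KERNEL of `kFibΔLim (Lc^m)` (`PerfectSymbolKBloch`), it decays,
# is block-covariant and reflection-invariant at blocking `Lc^m`, and `dec Lc (KPerf … (m+1)) = unitK Lc⁻¹ Lc⁻⁴ (KPerf … m)` (`StationarityK`) for EVERY `m`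

NOT IN PRINT; OUR PROOF.  The estimate is `PerfectResolventFibre.RealRateKM 3 Lc m (cFF (Lc^m) + cMF (Lc^m) + cMF (Lc^m) + cmm (Lc^m)) (Lc⁻²)` (§2,
`realRateKM_holds`): the four (j, m) leg rates of `FibreRateJM` (road P1's row-L11 cores at ratio `Lc^m` + this lineage's `FibreRateTBlockRatio`) assembled on the
closed form `AliasObjects.kFibClosedW` (§1: the multiplier-leg phases `e^{±ip·quo_N(M•x′)}` are LEVEL-FREE, `quo (Lc^(j+m)) (Lc^j•x′) = quo (Lc^m) x′`), transferred
to `kFibM … m j = kFibW (Lc^(j+m)) (Lc^j) …` on the punctured zone by leaf-05's `KFibClosedBridge.kFibW_eq_kFibClosedW` and to `q = 0` by leaf-08's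
`FibreContinuity.norm_sub_le_on_BZ_of_punctured` — exactly road P1's L11 → L12 route (`FibreRateOfLegs.realRateK_of_leg_rates`) at relative blocking `Lc^m`.
§3 then DISCHARGES the `hconv` hypothesis (X1m-K) of the landed FP leaves BY NAME: `PerfectResolventFibre.exists_tendsto_KTot_of_realRateKM`,
`PerfectRebase.KPerf_eq_KPerf_pow_base_holds_of_exists_tendsto` ∕ `kernelSide_KPerf_of_exists_tendsto_holds`, `PerfectSymbolKBloch.KPerf_eq_bloch_of_exists_tendsto`,
`StationarityK.dec_KPerf_succ_of_geometric` (with `KSlotHolds.sfStep_succ` ∕ `smStep_succ`).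
HONEST FRAMING (cell contract, verbatim): «discharging `BetaPertH` makes Bałaban's UV stability UNCONDITIONAL — a real constructive-QFT result; it is NOT the
continuum limit and NOT the Clay problem.»  HONEST DEPENDENCY (verbatim): «continuum YM on T⁴ ⇐ BetaPertH ∧ nine spine estimates (0/9 proved); BetaPertH ⇐ (D1) ∧
(D4) ∧ CAP+tail; G-an2-4 gates asym, D1 and NE2/3/4.»  HEADLINE DISCIPLINE: this closes road FP's located input X1m-K (rows X1m-der ∕ X1m-K of
`HOME/b2b-balaban-beta-d1-p3/LEAVES-FP.md`) and gives leaf N0b-K in named-limit form for every `m`; it does NOT close N0b-K's alias CLOSED form, N2 ∕ N5 ∕ N7, the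
step law, or anything of the wall: 0 wall binders instantiated; NEVER «G-an2-4 closed», NOT BetaPertH, NOT continuum, NOT Clay.

ABSOLUTE RULE (cell, verbatim): «No internally-minted statement may enter as a cited fact. Every hypothesis is either kernel-proved in this package or a
verbatim quotation of a PUBLISHED theorem with page reference.»  Nothing is cited; no `def`; every input is a tree theorem imported BY NAME.
-/

noncomputable section

open Complex Finset Filter Topology
open scoped BigOperators Real

namespace Summit.QuantumFields.BalabanUV.Beta.GAN24.RealRateKMHolds

open Literature.Probability.LatticeModels (TorusSite Torus.proj)
open Literature.MathematicalPhysics.QuantumFieldTheory.LatticeForm (quo repZ)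
open Literature.MathematicalPhysics.QuantumFieldTheory.Balaban1983to89.B4Strip (ofRealVec)
open Literature.MathematicalPhysics.QuantumFieldTheory.Balaban1983to89.B4ContourShift (BZ latticeKernel)
open Literature.MathematicalPhysics.QuantumFieldTheory.Balaban1983to89.Beta.ExpKernelCalculus (MKer Decays shiftK)
open Literature.MathematicalPhysics.QuantumFieldTheory.Balaban1983to89.Beta.KernelReflection (refK)
open Literature.MathematicalPhysics.QuantumFieldTheory.Balaban1983to89.Beta.ResolventReflection (Φ)
open Literature.MathematicalPhysics.QuantumFieldTheory.Balaban1983to89.Beta.FibreInverseDecay (cphase)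
open Literature.MathematicalPhysics.QuantumFieldTheory.Balaban1983to89.Beta.OneStepResolventKernel (Fib)
open Literature.MathematicalPhysics.QuantumFieldTheory.Balaban1983to89.Beta.OneStepKernelFamily (dec)
open Summit.QuantumFields.BalabanUV.Beta.HessKerDressedUnits (unitK)
open AliasObjects (kFibClosedW readW Ahat phiSol fhatF eVec)
open CombesThomas (sfStep smStep)
open CombesThomasFibre (LegOn)
open CombesThomasFibreStep (kFibW)
open KFibClosedBridge (kFibW_eq_kFibClosedW)
open FibreContinuity (norm_sub_le_on_BZ_of_punctured continuous_kFibW_ofRealVec)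
open FibreStepResidues (norm_cphase_ofRealVec)
open FibreRate (cFF cMF)
open FibreRateOfLegs (cmm)
open FibreRateJM (mm_leg mf_leg fm_leg ff_leg)
open PerfectStepFibre (theta_nonneg_lt_one)
open PerfectStepBloch (kFibΔLim)
open PerfectResolventFibre (kFibM kFibMLim RealRateKM exists_tendsto_KTot_of_realRateKM tendsto_KTot_KPerf_of_realRateKM abs_KTot_sub_KPerf_le
  KPerf_eq_fibre_of_realRateKM)
open Summit.QuantumFields.BalabanUV.Beta.FP.PerfectObjects (KTot)
open Summit.QuantumFields.BalabanUV.Beta.FP.PerfectObjectsT (KPerf)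
open Summit.QuantumFields.BalabanUV.Beta.FP.PerfectRebase (KPerf_eq_KPerf_pow_base_holds_of_exists_tendsto kernelSide_KPerf_of_exists_tendsto_holds)
open Summit.QuantumFields.BalabanUV.Beta.FP.PerfectSymbolKBloch (KPerf_eq_bloch_of_exists_tendsto)
open Summit.QuantumFields.BalabanUV.Beta.FP.StationarityK (dec_KPerf_succ_of_geometric)
open Summit.QuantumFields.BalabanUV.Beta.FP.KSlotHolds (sfStep_succ smStep_succ)

variable {Lc : ℕ} [NeZero Lc]

/-! ## §1 The multiplier-leg phases are level-free: `quo (Lc^(j+m)) (Lc^j • x′) = quo (Lc^m) x′` -/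

/-- [folklore] **`quo (Lc^(j+m)) (Lc^j • x′) = quo (Lc^m) x′`** — the `Lc^(j+m)`-block index of the `Lc^j`-scaled coarse point is its `Lc^m`-block index, the same at
every level `j` (Euclidean division; `ClosedFormRateOfParts.quo_step` is `m = 1`). -/
theorem quo_pow_step (m j : ℕ) (x' : Fin (3 + 1) → ℤ) : quo (Lc ^ (j + m)) (((Lc ^ j : ℕ) : ℤ) • x') = quo (Lc ^ m) x' := by
  funext i
  have hpos : (0 : ℤ) < (Lc : ℤ) ^ j := pow_pos (by exact_mod_cast Nat.pos_of_ne_zero (NeZero.ne Lc)) j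
  simp only [quo, Pi.smul_apply, smul_eq_mul]
  push_cast
  rw [pow_add, Int.mul_ediv_mul_of_pos _ _ hpos]

/-! ## §2 The one-step difference of the closed form at (j, m), and `RealRateKM` -/

/-- [folklore] **UNIFORM PLUG FORM FOR THE (j, m) ONE-STEP DIFFERENCE OF THE CLOSED FORM** at real `q` (the `m`-analogue of
`ClosedFormRateOfParts.norm_kFibClosed_succ_sub_le_of_parts`): leg bounds `C_ff, C_fm, C_mf, C_mm ≥ 0` in the shapes of `FibreRateJM` give, for every leg pair,
`‖kFibClosedW (Lc^(j+1+m)) (Lc^(j+1)) (sf_{j+1}) (sm_{j+1}) … (q) − kFibClosedW (Lc^(j+m)) (Lc^j) (sf_j) (sm_j) … (q)‖ ≤ C_ff + C_fm + C_mf + C_mm`. -/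
theorem norm_kFibClosedW_jm_succ_sub_le_of_parts (m j : ℕ) (q : Fin (3 + 1) → ℝ) {Cff Cfm Cmf Cmm : ℝ}
    (hCff : 0 ≤ Cff) (hCfm : 0 ≤ Cfm) (hCmf : 0 ≤ Cmf) (hCmm : 0 ≤ Cmm)
    (hff : ∀ κ l x' y', ‖((sfStep Lc (j + 1) * sfStep Lc (j + 1) : ℝ) : ℂ) * ∑ n', readW (Lc ^ (j + 1 + m)) (Lc ^ (j + 1)) (ofRealVec q) n' κ x' *
          Ahat (Lc ^ (j + 1 + m)) (ofRealVec q) (fhatF (Lc ^ (j + 1 + m)) (Lc ^ (j + 1)) (ofRealVec q) l y') 0 n' κ -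
        ((sfStep Lc j * sfStep Lc j : ℝ) : ℂ) * ∑ n, readW (Lc ^ (j + m)) (Lc ^ j) (ofRealVec q) n κ x' *
          Ahat (Lc ^ (j + m)) (ofRealVec q) (fhatF (Lc ^ (j + m)) (Lc ^ j) (ofRealVec q) l y') 0 n κ‖ ≤ Cff)
    (hfm : ∀ κ l x', ‖((sfStep Lc (j + 1) * smStep 3 Lc (j + 1) : ℝ) : ℂ) * ∑ n', readW (Lc ^ (j + 1 + m)) (Lc ^ (j + 1)) (ofRealVec q) n' κ x' *
          Ahat (Lc ^ (j + 1 + m)) (ofRealVec q) 0 (eVec l) n' κ -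
        ((sfStep Lc j * smStep 3 Lc j : ℝ) : ℂ) * ∑ n, readW (Lc ^ (j + m)) (Lc ^ j) (ofRealVec q) n κ x' * Ahat (Lc ^ (j + m)) (ofRealVec q) 0 (eVec l) n κ‖ ≤ Cfm)
    (hmf : ∀ κ l y', ‖((smStep 3 Lc (j + 1) * sfStep Lc (j + 1) : ℝ) : ℂ) *
          phiSol (Lc ^ (j + 1 + m)) (ofRealVec q) (fhatF (Lc ^ (j + 1 + m)) (Lc ^ (j + 1)) (ofRealVec q) l y') 0 κ -
        ((smStep 3 Lc j * sfStep Lc j : ℝ) : ℂ) * phiSol (Lc ^ (j + m)) (ofRealVec q) (fhatF (Lc ^ (j + m)) (Lc ^ j) (ofRealVec q) l y') 0 κ‖ ≤ Cmf)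
    (hmm : ∀ κ l, ‖((smStep 3 Lc (j + 1) * smStep 3 Lc (j + 1) : ℝ) : ℂ) * phiSol (Lc ^ (j + 1 + m)) (ofRealVec q) 0 (eVec l) κ -
        ((smStep 3 Lc j * smStep 3 Lc j : ℝ) : ℂ) * phiSol (Lc ^ (j + m)) (ofRealVec q) 0 (eVec l) κ‖ ≤ Cmm)
    (a : Fib 3) (x' : Fin (3 + 1) → ℤ) (b : Fib 3) (y' : Fin (3 + 1) → ℤ) :
    ‖kFibClosedW (Lc ^ (j + 1 + m)) (Lc ^ (j + 1)) (sfStep Lc (j + 1)) (smStep 3 Lc (j + 1)) a x' b y' (ofRealVec q) -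
        kFibClosedW (Lc ^ (j + m)) (Lc ^ j) (sfStep Lc j) (smStep 3 Lc j) a x' b y' (ofRealVec q)‖ ≤ Cff + Cfm + Cmf + Cmm := by
  rcases a with κ | κ <;> rcases b with l | l
  · rw [ClosedFormBoundOfParts.kFibClosedW_ff, ClosedFormBoundOfParts.kFibClosedW_ff]
    linarith [hff κ l x' y']
  · rw [ClosedFormBoundOfParts.kFibClosedW_fm, ClosedFormBoundOfParts.kFibClosedW_fm, quo_pow_step m (j + 1), quo_pow_step m j]
    have e : ∀ (s s' A A' c : ℂ), s' * c * A' - s * c * A = c * (s' * A' - s * A) := fun _ _ _ _ _ => by ring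
    rw [e, norm_mul, norm_cphase_ofRealVec, one_mul]
    linarith [hfm κ l x']
  · rw [ClosedFormBoundOfParts.kFibClosedW_mf, ClosedFormBoundOfParts.kFibClosedW_mf, quo_pow_step m (j + 1), quo_pow_step m j]
    have e : ∀ (s s' A A' c : ℂ), s' * c * A' - s * c * A = c * (s' * A' - s * A) := fun _ _ _ _ _ => by ring
    rw [e, norm_mul, norm_cphase_ofRealVec, one_mul]
    linarith [hmf κ l y']
  · rw [ClosedFormBoundOfParts.kFibClosedW_mm, ClosedFormBoundOfParts.kFibClosedW_mm, quo_pow_step m (j + 1), quo_pow_step m j,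
      quo_pow_step m (j + 1), quo_pow_step m j]
    have e : ∀ (s s' A A' c : ℂ), s' * c * A' - s * c * A = c * (s' * A' - s * A) := fun _ _ _ _ _ => by ring
    rw [e, norm_mul, norm_cphase_ofRealVec, one_mul]
    linarith [hmm κ l]

/-- **X1m-K AT THE FIBRE LEVEL HOLDS — `RealRateKM 3 Lc m (cFF (Lc^m) + cMF (Lc^m) + cMF (Lc^m) + cmm (Lc^m)) (Lc⁻²)` for every `Lc ≥ 2`, `m ≥ 1`** [our proof,
kernel-checked]: the `j`-geometric real-zone rate of the (j, m)-fibre functions `kFibM … m j = kFibW (Lc^(j+m)) (Lc^j) (sf_j) (sm_j)` on the whole Brillouin zone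
(legs `FibreRateJM.ff_leg ∕ fm_leg ∕ mf_leg ∕ mm_leg` on `BZ ∖ {0}` through §2 and the bridge `KFibClosedBridge.kFibW_eq_kFibClosedW`, the point `q = 0` by
`FibreContinuity.norm_sub_le_on_BZ_of_punctured`).  At `m = 1` this is road P1's `FibreRate.realRateK` (`PerfectResolventFibre.realRateKM_one_iff`). -/
theorem realRateKM_holds (hLc : 2 ≤ Lc) {m : ℕ} (hm : 1 ≤ m) :
    RealRateKM 3 Lc m (cFF (Lc ^ m) + cMF (Lc ^ m) + cMF (Lc ^ m) + cmm (Lc ^ m)) (((Lc : ℝ) ^ 2)⁻¹) := by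
  intro j x' y' a b
  refine norm_sub_le_on_BZ_of_punctured
    (continuous_kFibW_ofRealVec (Lc ^ (j + 1)) (sfStep Lc (j + 1)) (smStep 3 Lc (j + 1)) a x' b y')
    (continuous_kFibW_ofRealVec (Lc ^ j) (sfStep Lc j) (smStep 3 Lc j) a x' b y') ?_
  intro p hp hp0
  show ‖kFibW (Lc ^ (j + 1 + m)) (Lc ^ (j + 1)) (sfStep Lc (j + 1)) (smStep 3 Lc (j + 1)) a x' b y' (ofRealVec p) -
      kFibW (Lc ^ (j + m)) (Lc ^ j) (sfStep Lc j) (smStep 3 Lc j) a x' b y' (ofRealVec p)‖ ≤ _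
  rw [kFibW_eq_kFibClosedW hp hp0, kFibW_eq_kFibClosedW hp hp0]
  have h0ff : 0 ≤ cFF (Lc ^ m) * (((Lc : ℝ) ^ 2)⁻¹) ^ j := (norm_nonneg _).trans (ff_leg hLc hm j hp hp0 0 0 0 0)
  have h0fm : 0 ≤ cMF (Lc ^ m) * (((Lc : ℝ) ^ 2)⁻¹) ^ j := (norm_nonneg _).trans (fm_leg m j hp hp0 0 0 0)
  have h0mf : 0 ≤ cMF (Lc ^ m) * (((Lc : ℝ) ^ 2)⁻¹) ^ j := (norm_nonneg _).trans (mf_leg m j hp hp0 0 0 0)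
  have h0mm : 0 ≤ cmm (Lc ^ m) * (((Lc : ℝ) ^ 2)⁻¹) ^ j := (norm_nonneg _).trans (mm_leg m j hp hp0 0 0)
  have h := norm_kFibClosedW_jm_succ_sub_le_of_parts m j p h0ff h0fm h0mf h0mm
    (fun κ l x' y' => ff_leg hLc hm j hp hp0 κ l x' y') (fun κ l x' => fm_leg m j hp hp0 κ l x') (fun κ l y' => mf_leg m j hp hp0 κ l y')
    (fun κ l => mm_leg m j hp hp0 κ l) a x' b y'
  refine h.trans (le_of_eq ?_)
  ring

/-! ## §3 X1m-K and its consequences, unconditional (`d = 3`, `Lc ≥ 2`, `m ≥ 1`) -/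

/-- **X1m-K HOLDS** [our proof]: for every `Lc ≥ 2`, `m ≥ 1`, every entry of the unit-rescaled (j, m)-family `unitK (sfStep Lc j) (smStep 3 Lc j) (KTot (Lc^(j+m)) (Lc^j))`
converges as `j → ∞` — LITERALLY the `hconv` hypothesis of `FP.PerfectRebase.KPerf_eq_KPerf_pow_base_holds_of_exists_tendsto`, `FP.SymmetryK`, `FP.PerfectSymbolKBloch`,
`FP.StationarityK` (the located open input X1m-K ∕ X1m-der of road FP), now a theorem. -/
theorem exists_tendsto_KTot_holds (hLc : 2 ≤ Lc) {m : ℕ} (hm : 1 ≤ m) :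
    ∀ (x y : Fin (3 + 1) → ℤ) (a b : Fib 3), ∃ L : ℝ,
      Tendsto (fun j => unitK (sfStep Lc j) (smStep 3 Lc j) (KTot (d := 3) (Lc ^ (j + m)) (Lc ^ j)) x y a b) atTop (𝓝 L) :=
  exists_tendsto_KTot_of_realRateKM (theta_nonneg_lt_one hLc).1 (theta_nonneg_lt_one hLc).2 (realRateKM_holds hLc hm)

/-- **… WITH THE LIMIT NAMED AND AN EXPLICIT SUP-NORM RATE** [our proof]: the limit is `KPerf Lc (sfStep Lc) (smStep 3 Lc) m` and
`|unitK_j (KTot (Lc^(j+m)) (Lc^j)) x′ y′ a b − KPerf … m x′ y′ a b| ≤ (cFF + cMF + cMF + cmm)(Lc^m)·(Lc⁻²)^j∕(1 − Lc⁻²)`. -/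
theorem abs_KTot_sub_KPerf_holds (hLc : 2 ≤ Lc) {m : ℕ} (hm : 1 ≤ m) (j : ℕ) (x' y' : Fin (3 + 1) → ℤ) (a b : Fib 3) :
    |unitK (sfStep Lc j) (smStep 3 Lc j) (KTot (d := 3) (Lc ^ (j + m)) (Lc ^ j)) x' y' a b - KPerf (d := 3) Lc (sfStep Lc) (smStep 3 Lc) m x' y' a b| ≤
      (cFF (Lc ^ m) + cMF (Lc ^ m) + cMF (Lc ^ m) + cmm (Lc ^ m)) * (((Lc : ℝ) ^ 2)⁻¹) ^ j / (1 - ((Lc : ℝ) ^ 2)⁻¹) :=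
  abs_KTot_sub_KPerf_le (theta_nonneg_lt_one hLc).1 (theta_nonneg_lt_one hLc).2 (realRateKM_holds hLc hm) j x' y' a b

/-- [our proof] Entrywise convergence to the perfect `m`-fold resolvent. -/
theorem tendsto_KTot_KPerf_holds (hLc : 2 ≤ Lc) {m : ℕ} (hm : 1 ≤ m) (x' y' : Fin (3 + 1) → ℤ) (a b : Fib 3) :
    Tendsto (fun j => unitK (sfStep Lc j) (smStep 3 Lc j) (KTot (d := 3) (Lc ^ (j + m)) (Lc ^ j)) x' y' a b) atTop
      (𝓝 (KPerf (d := 3) Lc (sfStep Lc) (smStep 3 Lc) m x' y' a b)) :=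
  tendsto_KTot_KPerf_of_realRateKM (theta_nonneg_lt_one hLc).1 (theta_nonneg_lt_one hLc).2 (realRateKM_holds hLc hm) x' y' a b

/-- **THE PERFECT `m`-FOLD RESOLVENT IS THE PERFECT ONE-STEP RESOLVENT AT BASE `Lc^m` — UNCONDITIONAL** [our proof] (`FP.PerfectRebase`, its `hconv` discharged). -/
theorem KPerf_eq_KPerf_pow_base_holds (hLc : 2 ≤ Lc) {m : ℕ} (hm : 1 ≤ m) :
    KPerf (d := 3) Lc (sfStep Lc) (smStep 3 Lc) m = KPerf (d := 3) (Lc ^ m) (sfStep (Lc ^ m)) (smStep 3 (Lc ^ m)) 1 :=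
  KPerf_eq_KPerf_pow_base_holds_of_exists_tendsto hm (exists_tendsto_KTot_holds hLc hm)

/-- **THE PERFECT `m`-FOLD RESOLVENT DECAYS, IS BLOCK-COVARIANT AND REFLECTION-INVARIANT AT BLOCKING `Lc^m` — UNCONDITIONAL** [our proof]
(`FP.PerfectRebase.kernelSide_KPerf_of_exists_tendsto_holds`, its `hconv` discharged). -/
theorem kernelSide_KPerf_holds (hLc : 2 ≤ Lc) {m : ℕ} (hm : 1 ≤ m) :
    (∃ δ₀ C₀ : ℝ, 0 < δ₀ ∧ 0 ≤ C₀ ∧ Decays (KPerf (d := 3) Lc (sfStep Lc) (smStep 3 Lc) m) C₀ δ₀) ∧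
    (∀ t : Fin (3 + 1) → ℤ, shiftK (-(((Lc ^ m : ℕ) : ℤ) • t)) (KPerf (d := 3) Lc (sfStep Lc) (smStep 3 Lc) m) = KPerf Lc (sfStep Lc) (smStep 3 Lc) m) ∧
    (∀ α : Fin (3 + 1), refK (Φ (d := 3) (Lc ^ m) α) (KPerf (d := 3) Lc (sfStep Lc) (smStep 3 Lc) m) = KPerf Lc (sfStep Lc) (smStep 3 Lc) m) :=
  kernelSide_KPerf_of_exists_tendsto_holds hLc hm (exists_tendsto_KTot_holds hLc hm)

/-- **LEAF N0b-K FOR EVERY `m`, ALL FOUR QUARTERS, IN BLOCH FORM — UNCONDITIONAL** [our proof]: the perfect `m`-fold resolvent is the Bloch kernel on the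
`Lc^m`-blocks of this lineage's re-based limit fibre function at base `Lc^m`:
`KPerf Lc (sfStep Lc) (smStep 3 Lc) m x′ y′ a b = [LegOn (Lc^m) a x′ ∧ LegOn (Lc^m) b y′] · Re latticeKernel (kFibΔLim (Lc^m) a (repZ (proj (Lc^m) x′)) b (repZ (proj (Lc^m) y′))) (quo (Lc^m) x′ − quo (Lc^m) y′)`. -/
theorem KPerf_eq_bloch_holds (hLc : 2 ≤ Lc) {m : ℕ} (hm : 1 ≤ m) (x' y' : Fin (3 + 1) → ℤ) (a b : Fib 3) :
    KPerf (d := 3) Lc (sfStep Lc) (smStep 3 Lc) m x' y' a b =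
      if LegOn (Lc ^ m) a x' ∧ LegOn (Lc ^ m) b y' then
        (latticeKernel (kFibΔLim (Lc ^ m) a (repZ (Torus.proj (Lc ^ m) x')) b (repZ (Torus.proj (Lc ^ m) y')))
          (quo (Lc ^ m) x' - quo (Lc ^ m) y')).re
      else 0 :=
  KPerf_eq_bloch_of_exists_tendsto hLc hm (exists_tendsto_KTot_holds hLc hm) x' y' a b

/-- [our proof] The same in the `(j, m)`-fibre currency of `PerfectResolventFibre`: `KPerf … m x′ y′ a b = [LegOn (Lc^m) …] · Re latticeKernel (kFibMLim Lc m a x′ b y′) 0`. -/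
theorem KPerf_eq_fibre_holds (hLc : 2 ≤ Lc) {m : ℕ} (hm : 1 ≤ m) (x' y' : Fin (3 + 1) → ℤ) (a b : Fib 3) :
    KPerf (d := 3) Lc (sfStep Lc) (smStep 3 Lc) m x' y' a b =
      if LegOn (Lc ^ m) a x' ∧ LegOn (Lc ^ m) b y' then (latticeKernel (kFibMLim Lc m a x' b y') 0).re else 0 :=
  KPerf_eq_fibre_of_realRateKM (theta_nonneg_lt_one hLc).1 (theta_nonneg_lt_one hLc).2 (realRateKM_holds hLc hm) x' y' a b

/-- **THE FIXED-POINT PROPERTY FOR EVERY `m` — UNCONDITIONAL** [our proof]: one more `Lc`-decimation of the perfect `(m+1)`-fold resolvent is the perfect `m`-fold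
resolvent in the once-shifted units, `dec Lc (KPerf … (m+1)) = unitK Lc⁻¹ (Lc⁴)⁻¹ (KPerf … m)` (`FP.StationarityK.dec_KPerf_succ_of_geometric`, its `hconv` = X1m-K at
`m + 1` discharged; `m = 0` is `FP.KSlotHolds.dec_KPerf_one_holds`). -/
theorem dec_KPerf_succ_holds (hLc : 2 ≤ Lc) (m : ℕ) :
    dec Lc (KPerf (d := 3) Lc (sfStep Lc) (smStep 3 Lc) (m + 1)) =
      unitK ((Lc : ℝ))⁻¹ ((Lc : ℝ) ^ (3 + 1))⁻¹ (KPerf (d := 3) Lc (sfStep Lc) (smStep 3 Lc) m) := by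
  have hLc0 : (Lc : ℝ) ≠ 0 := Nat.cast_ne_zero.2 (NeZero.ne Lc)
  exact dec_KPerf_succ_of_geometric (d := 3) (Lc := Lc) (sf := sfStep Lc) (sm := smStep 3 Lc) (m := m) hLc0 (pow_ne_zero _ hLc0)
    (sfStep_succ Lc) (smStep_succ Lc) (exists_tendsto_KTot_holds hLc (m := m + 1) (by omega))

end Summit.QuantumFields.BalabanUV.Beta.GAN24.RealRateKMHolds

end
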